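import Mathlib
import HarnessLib
import Summits.CriticalPhenomena.PercolationContinuityZ3.Theses.PercLowPointHalfSpace
import Literature.Probability.Percolation.LatticeSymmetry
import Literature.Probability.Percolation.SharpnessDCTProofs
import Literature.Probability.Percolation.SiteConnectionTools
import Literature.Probability.Percolation.RSW

/-!
# Crux `LowPointBookkeeping` (stmt-CriticalPhenomena-14713): cube exit `θ(p) ≤ 6 · P_p(W_r)`

Helper file for the crux item `stmt-CriticalPhenomena-14713` (`LowPointBookkeeping`, K) of route
`CriticalPhenomena/PercLowPointHalfSpace` (lands `--supports stmt-CriticalPhenomena-14713`, registered stub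
`stub_cubeExit`; line `SketchIdeator4`, skeleton `stem-criterion`, lead a1).

CUBE EXIT (bond percolation on `ℤ³`, EVERY `p`, every `r : ℕ`): with the apex `x* = r e₀ = Pi.single 0 r`,
the cube `Q_r(x*) = {y | ∀ i, |y i - x* i| ≤ r} = x* + Λ_r` (bottom face on the floor `∂ℍ = {y₀ = 0}`) and the
localised point-to-wall event `W_r = {x* ↔ ∂ℍ inside Q_r(x*)}`,

  `θ(p) ≤ 6 · P_p(W_r)`.

Proof: `θ(p) = P_p(|C(0)| = ∞) ≤ P_p(0 ↔ ∂Λ_r inside Λ_r)` (first exit of an infinite cluster,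
`DCT16.theta_le_real_siteToBoundary`); the one-arm event is covered by the six face events
`F_{i,s}(r) = {0 ↔ some y ∈ Λ_r with y_i = s·r, inside Λ_r}` (`i : Fin 3`, `s = ±1`), which are images of
one another under the signed coordinate permutations of `ℤ³` fixing `0` and `Λ_r` (`zdSignedPermIso`), hence
equiprobable (`bondPercolation_real_image`); so `θ(p) ≤ 6 · P_p(F_{0,-1}(r))`, and the bottom face event
translated by `+r e₀` (`real_openCrossing_shift`) is contained in `W_r` (`Λ_r + r e₀ = Q_r(x*)`,
`0 + r e₀ = x*`, `{y₀ = -r} + r e₀ ⊆ ∂ℍ`).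

The helper lemmas of `namespace CubeExit` are adapted from the tree workfile
`Cruxes/FreeBoxSparse/Lines/axis_fold_linear_depth_bgn.lean` (§7.5, `faceEvent`,
`siteToBoundary_subset_iUnion_faceEvent`, `image_signedPerm_face`, `real_faceEvent_eq`,
`real_faceEvent_le_liftedRootProb`, `theta_le_six_mul_liftedRootProb`), with the face event written inline.

Sources: G. Grimmett, *Percolation* (1999), §1.4 (`θ(p) ≤ P_p(0 ↔ ∂B(n))`), §1.6 (invariance of `P_p` under
lattice symmetries).
-/

noncomputable section

open MeasureTheory Filter Topology
open Literature.Probability.Percolation Literature.Probability.LatticeModels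
open scoped ENNReal Classical

namespace Summit.CriticalPhenomena.PercolationContinuityZ3.Theorems.StemCriterion

open Summit.CriticalPhenomena.PercolationContinuityZ3.Theses.PercLowPointHalfSpace

namespace CubeExit

/-- The face event `F_{i,s}(r) = {0 ↔ some y ∈ Λ_r with y_i = s·r, inside Λ_r}` (`s = ±1`; local notation). -/
local notation3 (prettyPrint := false) "Face[" r "," i "," s "]" =>
  openCrossing (↑(box 3 r) : Set (Site 3)) ({0} : Set (Site 3))
    {y : Site 3 | y ∈ box 3 r ∧ y i = ((s : ℤˣ) : ℤ) * ((r : ℕ) : ℤ)}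

/-- The one-arm event `{0 ↔ ∂Λ_r inside Λ_r}` is covered by the six face events. [folklore] -/
theorem siteToBoundary_subset_iUnion_face (r : ℕ) :
    siteToBoundary 3 r ⊆ ⋃ q : Fin 3 × ℤˣ, Face[r, q.1, q.2] := by
  -- adapted from Cruxes/FreeBoxSparse/Lines/axis_fold_linear_depth_bgn.lean
  rintro ω ⟨y, hy, hω⟩
  have hyb : y ∈ box 3 r := (mem_innerBoundary_iff.1 hy).1
  obtain ⟨i, hi | hi⟩ := exists_eq_of_mem_innerBoundary_box hy
  · exact Set.mem_iUnion.2 ⟨(i, 1), 0, rfl, y, ⟨hyb, by simpa using hi⟩, hω⟩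
  · exact Set.mem_iUnion.2 ⟨(i, -1), 0, rfl, y, ⟨hyb, by simpa using hi⟩, hω⟩

/-- The signed permutation `σ_{i,s}` (swap `0 ↔ i`, sign `s` on slot `i`) maps the face `{y₀ = r}` of `Λ_r`
onto the face `{y_i = s·r}`. [folklore] -/
theorem image_signedPerm_face (r : ℕ) (i : Fin 3) (s : ℤˣ) :
    (Site.signedPerm (Equiv.swap 0 i) (Function.update (fun _ => (1 : ℤˣ)) i s)) ''
        {y : Site 3 | y ∈ box 3 r ∧ y 0 = (((1 : ℤˣ) : ℤ)) * ((r : ℕ) : ℤ)} =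
      {y : Site 3 | y ∈ box 3 r ∧ y i = (s : ℤ) * ((r : ℕ) : ℤ)} := by
  -- adapted from Cruxes/FreeBoxSparse/Lines/axis_fold_linear_depth_bgn.lean
  set σ := Site.signedPerm (Equiv.swap 0 i) (Function.update (fun _ => (1 : ℤˣ)) i s) with hσ
  have hcoord : ∀ y : Site 3, σ y i = (s : ℤ) * y 0 := by
    intro y
    rw [hσ, Site.signedPerm_apply, Equiv.symm_swap, Equiv.swap_apply_right]
    simp
  ext z
  constructor
  · rintro ⟨y, ⟨hyb, hy0⟩, rfl⟩
    refine ⟨(signedPerm_mem_box_iff _ _).2 hyb, ?_⟩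
    rw [hcoord, hy0, Units.val_one, one_mul]
  · rintro ⟨hzb, hzi⟩
    refine ⟨σ.symm z, ⟨?_, ?_⟩, σ.apply_symm_apply z⟩
    · have := (signedPerm_mem_box_iff (Equiv.swap 0 i) (Function.update (fun _ => (1 : ℤˣ)) i s)
        (x := σ.symm z) (n := r))
      rw [Equiv.apply_symm_apply] at this
      exact this.1 hzb
    · have h := hcoord (σ.symm z)
      rw [Equiv.apply_symm_apply] at h
      -- `z i = s * (σ⁻¹ z) 0`, and `s * s = 1`
      have hs : (s : ℤ) * (s : ℤ) = 1 := by
        rcases Int.units_eq_one_or s with h1 | h1 <;> simp [h1]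
      have h2 : (σ.symm z) 0 = (s : ℤ) * z i := by
        calc (σ.symm z) 0 = ((s : ℤ) * (s : ℤ)) * (σ.symm z) 0 := by rw [hs, one_mul]
          _ = (s : ℤ) * z i := by rw [mul_assoc, ← h]
      rw [h2, hzi, Units.val_one, one_mul, ← mul_assoc, hs, one_mul]

/-- All six face events are equiprobable (cube symmetry fixing `0` and `Λ_r`). [folklore] -/
theorem real_face_eq (p : unitInterval) (r : ℕ) (i : Fin 3) (s : ℤˣ) :
    (bondPercolation (zdGraph 3) p).real Face[r, i, s] =
      (bondPercolation (zdGraph 3) p).real Face[r, 0, 1] := by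
  -- adapted from Cruxes/FreeBoxSparse/Lines/axis_fold_linear_depth_bgn.lean
  set π : Equiv.Perm (Fin 3) := Equiv.swap 0 i
  set ε : Fin 3 → ℤˣ := Function.update (fun _ => (1 : ℤˣ)) i s
  have h := bondPercolation_real_image (zdSignedPermIso π ε) p
    (↑(box 3 r) : Set (Site 3)) {0} {y : Site 3 | y ∈ box 3 r ∧ y 0 = (((1 : ℤˣ) : ℤ)) * ((r : ℕ) : ℤ)}
  have hbox : ⇑(zdSignedPermIso π ε) '' (↑(box 3 r) : Set (Site 3)) = ↑(box 3 r) :=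
    signedPerm_image_box π ε r
  have h0 : ⇑(zdSignedPermIso π ε) '' ({0} : Set (Site 3)) = {0} := by
    rw [Set.image_singleton, zdSignedPermIso_apply, Site.signedPerm_zero]
  have hface : ⇑(zdSignedPermIso π ε) ''
      {y : Site 3 | y ∈ box 3 r ∧ y 0 = (((1 : ℤˣ) : ℤ)) * ((r : ℕ) : ℤ)} =
      {y : Site 3 | y ∈ box 3 r ∧ y i = (s : ℤ) * ((r : ℕ) : ℤ)} :=
    image_signedPerm_face r i s
  rw [hbox, h0, hface] at h
  exact h

/-- The bottom face event `F_{0,-1}(r)`, translated by `+r e₀`, lies inside the cube-exit event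
`W_r = {r e₀ ↔ ∂ℍ inside Q_r(r e₀)}`. [folklore] -/
theorem real_face_le_cubeExit (p : unitInterval) (r : ℕ) :
    (bondPercolation (zdGraph 3) p).real Face[r, 0, -1] ≤
      (bondPercolation (zdGraph 3) p).real {ω | ∃ f : Site 3, f 0 = 0 ∧
        ω ∈ openConnIn {y : Site 3 | ∀ i : Fin 3, |y i - (Pi.single 0 (r : ℤ) : Site 3) i| ≤ (r : ℤ)}
          (Pi.single 0 (r : ℤ) : Site 3) f} := by
  -- adapted from Cruxes/FreeBoxSparse/Lines/axis_fold_linear_depth_bgn.lean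
  have hshift := real_openCrossing_shift p (Pi.single 0 (r : ℤ) : Site 3) (↑(box 3 r) : Set (Site 3)) {0}
    {y : Site 3 | y ∈ box 3 r ∧ y 0 = (((-1 : ℤˣ)) : ℤ) * ((r : ℕ) : ℤ)}
  rw [← hshift]
  refine measureReal_mono ?_ (measure_ne_top _ _)
  refine (openCrossing_mono
    (S' := {y : Site 3 | ∀ i : Fin 3, |y i - (Pi.single 0 (r : ℤ) : Site 3) i| ≤ (r : ℤ)})
    (A' := {(Pi.single 0 (r : ℤ) : Site 3)}) (B' := {f : Site 3 | f 0 = 0}) ?_ ?_ ?_).trans ?_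
  · -- `Λ_r + r e₀ ⊆ Q_r(r e₀)`
    rintro _ ⟨x, hx, rfl⟩
    rw [Finset.mem_coe, mem_box] at hx
    simp only [Set.mem_setOf_eq, Pi.add_apply, add_sub_cancel_right]
    exact fun j => abs_le.2 (hx j)
  · -- `0 + r e₀ = r e₀`
    rintro _ ⟨x, hx, rfl⟩
    rw [Set.mem_singleton_iff] at hx
    subst hx
    simp
  · -- `{y₀ = -r} + r e₀ ⊆ ∂ℍ`
    rintro _ ⟨x, ⟨-, hx0⟩, rfl⟩
    simp at hx0 ⊢
    omega
  · rintro ω ⟨x, hx, y, hy, hω⟩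
    rw [Set.mem_singleton_iff] at hx
    subst hx
    exact ⟨y, hy, hω⟩

/-- **Cube exit**: `θ(p) ≤ 6 · P_p(W_r)` for every `p` and every `r`. [folklore] -/
theorem theta_le_six_mul_real_cubeExit (p : unitInterval) (r : ℕ) :
    theta (zdGraph 3) (0 : Site 3) p ≤ 6 * (bondPercolation (zdGraph 3) p).real {ω | ∃ f : Site 3, f 0 = 0 ∧
        ω ∈ openConnIn {y : Site 3 | ∀ i : Fin 3, |y i - (Pi.single 0 (r : ℤ) : Site 3) i| ≤ (r : ℤ)}
          (Pi.single 0 (r : ℤ) : Site 3) f} := by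
  -- adapted from Cruxes/FreeBoxSparse/Lines/axis_fold_linear_depth_bgn.lean
  calc theta (zdGraph 3) 0 p ≤ (bondPercolation (zdGraph 3) p).real (siteToBoundary 3 r) :=
        DCT16.theta_le_real_siteToBoundary p r
    _ ≤ (bondPercolation (zdGraph 3) p).real (⋃ q : Fin 3 × ℤˣ, Face[r, q.1, q.2]) :=
        measureReal_mono (siteToBoundary_subset_iUnion_face r) (measure_ne_top _ _)
    _ ≤ ∑ q : Fin 3 × ℤˣ, (bondPercolation (zdGraph 3) p).real Face[r, q.1, q.2] :=
        measureReal_iUnion_fintype_le _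
    _ = ∑ _q : Fin 3 × ℤˣ, (bondPercolation (zdGraph 3) p).real Face[r, 0, 1] :=
        Finset.sum_congr rfl fun q _ => real_face_eq p r q.1 q.2
    _ = 6 * (bondPercolation (zdGraph 3) p).real Face[r, 0, 1] := by
        rw [Finset.sum_const, nsmul_eq_mul]
        norm_num [Fintype.card_units_int]
    _ = 6 * (bondPercolation (zdGraph 3) p).real Face[r, 0, -1] := by
        rw [real_face_eq p r 0 (-1)]
    _ ≤ _ := by
        have := real_face_le_cubeExit p r
        linarith

end CubeExit

/-- **Registered stub `stub_cubeExit`** (CUBE EXIT, every `p`, every `r`; crux stmt-CriticalPhenomena-14713,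
line `SketchIdeator4`): `θ(p) ≤ 6 · P_p(r e₀ ↔ ∂ℍ inside r e₀ + [-r,r]³)`, verbatim the registered
signature. [folklore] -/
theorem stub_cubeExit : ∀ (p : unitInterval) (r : ℕ), theta (zdGraph 3) (0 : Site 3) p ≤ 6 * (bondPercolation (zdGraph 3) p).real {ω | ∃ f : Site 3, f 0 = 0 ∧ ω ∈ openConnIn {y : Site 3 | ∀ i : Fin 3, |y i - (Pi.single 0 (r : ℤ) : Site 3) i| ≤ (r : ℤ)} (Pi.single 0 (r : ℤ) : Site 3) f} :=
  fun p r => CubeExit.theta_le_six_mul_real_cubeExit p r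

end Summit.CriticalPhenomena.PercolationContinuityZ3.Theorems.StemCriterion

end
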